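import Mathlib
import Summits.Ventures.PercRepro2.HCov
import Summits.Ventures.PercRepro2.RootLeafUSigns
import Summits.Ventures.PercRepro2.RootLeafUHalf
import Summits.Ventures.PercRepro2.RootLeafUSecond
import Summits.Ventures.PercRepro2.RootLeafUSepB

/-!
# (G4-u) on the class «`u` separates the root `a₂` from `o`»: the `o ∈ K` half is free (blind cell
PercRepro2, p4 g8; S3 (G4-u), proofs/P4-G8-SEP.md §11)
On **`∀ ω, Conn ω a₂ o → Conn ω a₂ u`** the mark `o` is never in `K = C(a₂)` on `Q`, so every term of
the `o ∈ K` half except the world-0 term vanishes: **`T2oK = ℰ · e0`** (`SepUO.T2oK_sepUO_eq`), and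
`ℰ ≥ 0` (`Ee_nonneg`, BHK06 Thms 1.3 / 1.4) gives **`0 ≤ T2oK`** (`SepUO.T2oK_nonneg_of_sepUO`).  The
`o ∈ L` half is not simplified by this class (its masses are `L`-events).
-/

namespace Summit.Ventures.PercRepro2

open UnionCluster CovForm

namespace RootLeafU

namespace SepUO

section SepUO

variable {V : Type*} {E : Type*} [Fintype E] [DecidableEq E] [Fintype V] [DecidableEq V]
  {R : Type*} [Field R] [LinearOrder R] [IsStrictOrderedRing R]

variable (p : E → R) (ends : E → Sym2 V) (o a₂ c b u : V)

omit [Fintype E] [DecidableEq E] [Fintype V] [DecidableEq V] in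
/-- On the class, `o ∉ K` on `Q`: `Q ∩ {a₂ ↔ o} = ∅`. -/
lemma Q_inter_oK_eq_empty (hsep : ∀ ω : Config E, Conn ends ω a₂ o → Conn ends ω a₂ u) :
    avoidAll ends a₂ {u} ∩ connEvent ends a₂ o = ∅ := by
  ext ω
  simp only [Set.mem_inter_iff, mem_connEvent, Set.mem_empty_iff_false, iff_false, not_and]
  intro hQ ho
  exact hQ u (Finset.mem_singleton_self u) (hsep ω ho)

omit [Fintype V] [DecidableEq V] [LinearOrder R] [IsStrictOrderedRing R] in
/-- Any event inside `Q ∩ {a₂ ↔ o}` is null on the class. -/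
lemma prob_eq_zero_of_subset (hsep : ∀ ω : Config E, Conn ends ω a₂ o → Conn ends ω a₂ u)
    {A : Set (Config E)} (hA : A ⊆ avoidAll ends a₂ {u} ∩ connEvent ends a₂ o) : prob p A = 0 := by
  have : A = ∅ := Set.subset_eq_empty hA (Q_inter_oK_eq_empty ends o a₂ u hsep)
  rw [this, prob_empty]

omit [Fintype V] [DecidableEq V] [LinearOrder R] [IsStrictOrderedRing R] in
/-- **`T2oK = ℰ · e0`** on the class: every `o ∈ K` mass of `Q` vanishes. -/
theorem T2oK_sepUO_eq (hsep : ∀ ω : Config E, Conn ends ω a₂ o → Conn ends ω a₂ u) :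
    T2oK p ends o a₂ c b u =
      Ee p ends a₂ c b u * prob p (avoidAll ends a₂ {c} ∩ connEvent ends a₂ o) := by
  have z1 : prob p (PDEvent ends u a₂ c ∩ connEvent ends a₂ o) = 0 :=
    prob_eq_zero_of_subset p ends o a₂ u hsep
      (Set.inter_subset_inter_left _ (SepB.PDEvent_subset ends a₂ c u))
  have z2 : prob p (TEvent ends a₂ u c ∩ connEvent ends a₂ o) = 0 :=
    prob_eq_zero_of_subset p ends o a₂ u hsep
      (Set.inter_subset_inter_left _ (SepB.TEvent_swap_subset ends a₂ c u))
  have z3 : prob p (TEvent ends a₂ u c ∩ (connEvent ends a₂ o ∩ connEvent ends a₂ b)) = 0 :=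
    prob_eq_zero_of_subset p ends o a₂ u hsep
      (fun ω hω => ⟨SepB.TEvent_swap_subset ends a₂ c u hω.1, hω.2.1⟩)
  have z4 : prob p (PDEvent ends u a₂ c ∩ (connEvent ends a₂ o ∩ connEvent ends u b)) = 0 :=
    prob_eq_zero_of_subset p ends o a₂ u hsep
      (fun ω hω => ⟨SepB.PDEvent_subset ends a₂ c u hω.1, hω.2.1⟩)
  have z5 : prob p (TEvent ends a₂ u c ∩ (connEvent ends a₂ o ∩ connEvent ends u b)) = 0 :=
    prob_eq_zero_of_subset p ends o a₂ u hsep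
      (fun ω hω => ⟨SepB.TEvent_swap_subset ends a₂ c u hω.1, hω.2.1⟩)
  unfold T2oK
  rw [z1, z2, z3, z4, z5]
  ring

/-- **The `o ∈ K` half is non-negative on the class** (`Ee_nonneg`). -/
theorem T2oK_nonneg_of_sepUO (hp : IsProbVec p)
    (hsep : ∀ ω : Config E, Conn ends ω a₂ o → Conn ends ω a₂ u) :
    0 ≤ T2oK p ends o a₂ c b u := by
  rw [T2oK_sepUO_eq p ends o a₂ c b u hsep]
  exact mul_nonneg (Ee_nonneg p ends a₂ c b u hp) (prob_nonneg hp _)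

end SepUO

end SepUO

end RootLeafU

end Summit.Ventures.PercRepro2
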